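import Summits.NavierStokesRegularity.NavierStokesRegularity.Theses.RellichScar
import Summits.NavierStokesRegularity.NavierStokesRegularity.Theorems.RellichScarSymmetricScarExistsPineauVicolOneSlice
import Summits.NavierStokesRegularity.NavierStokesRegularity.Theorems.RellichScarSymmetricScarExistsGaussianWindowLaw
import Summits.NavierStokesRegularity.NavierStokesRegularity.Theorems.RellichScarSymmetricScarExistsSmallDefectSlice
import Summits.NavierStokesRegularity.NavierStokesRegularity.Theorems.RellichScarSymmetricScarExistsOneSliceCriterion
import Summits.NavierStokesRegularity.NavierStokesRegularity.Theorems.RellichScarSymmetricScarExistsApexLerayProfile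
import Summits.NavierStokesRegularity.NavierStokesRegularity.Theorems.RellichScarSymmetricScarExistsApexClassicalRepresentative
import Summits.NavierStokesRegularity.NavierStokesRegularity.Theorems.RellichScarSymmetricScarExistsApexScaleInvariantBoundsTimeDecay
import Summits.NavierStokesRegularity.NavierStokesRegularity.Theorems.RellichScarSymmetricScarExistsTypeITimeDerivDecay

/-!
# Line `logtime-bernoulli-certificate` for the crux `SymmetricScarExists` (stmt-NavierStokesRegularity-11718)

Lead prover's SKELETON, **v4 (continuation lead c2, 2026-08-16T14:05Z): `stub_typeITimeDerivDecay` is now the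
LANDED tree theorem (p91030, imported) — the ONLY `sorry`s left are the bet in its three strengths
(`stub_oneGoodSlice ⇐ stub_finiteGaussianAction ⇐ stub_logtimeBernoulliCertificate`); the by-product
`noApexTypeIProfile_of_stubs` shows the bet is at least X-strong (it proves the route TARGET), see
`Lines/logtime-bernoulli-certificate.dead.md`.**  History — v3 (after wave 2; v2 = after wave 1).  NOTE (wave 3, 08:30Z): the one
known-mathematics stub left below, `stub_typeITimeDerivDecay`, has meanwhile LANDED (p91030,
`Theorems/RellichScarSymmetricScarExistsTypeITimeDerivDecay.lean`); v4 of this file imports it and keeps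
ONLY the bet stubs — it replaces this version as soon as the check farm has built that module.  So the line
is CLOSED MODULO THE BET (`stub_oneGoodSlice` ⇐ `stub_finiteGaussianAction` ⇐ `stub_logtimeBernoulliCertificate`).  Wave 1 LANDED four of the seven original stubs
(`stub_pineauVicolOneSlice` p71896, `stub_smallDefectSlice` p72305, `stub_oneSliceCriterion` p72457,
`stub_gaussianWindowLaw` p72992+p73327) and REDUCED `stub_apexLerayProfile` to the scale-invariant
regularity of apex profiles (`stub_apexLerayProfile_ofRegularity`,
`apexLerayProfile_of_representative_of_bounds`, p73111+p73412); all under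
`Summits/…/Theorems/RellichScarSymmetricScarExists*.lean`, namespace
`Summit.NavierStokesRegularity.NavierStokesRegularity.Theorems.SymmetricScarExists.LogtimeBernoulli`.

## v3 (wave 2): STUB 1a LANDED (p74461, `stub_apexClassicalRepresentative`, via the sibling crux
ScarRigidity's landed `stub_apexMildRepresentative`); STUB 1b REDUCED by six landed files (p75084, p76080,
p77049, p78247, p78405, p87966: velocity bounds at all orders, Riesz pressure `pressurePotential` with
scale-invariant bounds, near/far potential smoothness) to ONE residual, registered below as
`stub_typeITimeDerivDecay` (decay at spatial infinity of the iterated TIME derivatives of a classical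
Type-I solution on compact windows — KNSS 2009 Prop. 4.1 + Lemma 3.1 with decay + Landau–Kolmogorov):
`stub_apexScaleInvariantBounds := stub_apexScaleInvariantBounds_ofTimeDerivDecay stub_typeITimeDerivDecay`.
Registered stubs (v3): `stub_typeITimeDerivDecay` (known math) + the bet in three strengths.

## Reshaped stub set (v2; re-registered with `ledger skeleton check`)

* `stub_apexClassicalRepresentative` (L–XL, KNOWN: KNSS 2009 Lemma 3.1 + Prop. 4.1, A–B 2019 §3):
  an apex suitable weak profile agrees a.e. on the slab with a CLASSICAL solution on `(−∞,0)`.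
* `stub_apexScaleInvariantBounds` (L–XL, KNOWN: Seregin–Šverák 2009 §2 at unit scale after the
  Navier–Stokes rescaling + Calderón–Zygmund bounds for the Riesz pressure): a classical Type-I
  solution on the past is classical with SOME pressure obeying the six scale-invariant bounds.
* `stub_oneGoodSlice` (THE BET in its WEAKEST sufficient form): every eternal backward-Leray profile
  in the weighted class `LB(C,K)` has, for every `δ, R > 0`, ONE slice with self-similar defect
  `‖∂ₛU‖ ≤ δ` on `B_R`.
* `stub_finiteGaussianAction` (stronger bet, the card's transfer target `C⁺`; ⇒ `stub_oneGoodSlice`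
  by the landed `stub_smallDefectSlice`) and `stub_logtimeBernoulliCertificate` (the card's
  certificate; ⇒ finite action by the landed window law, `finiteGaussianAction_of_certificate`;
  with an arbitrary slice functional `V` it is EQUIVALENT to a uniform finite action) are kept
  registered as the two stronger entry points of the same bet.

Composition: `noApexTypeIProfile_of_stubs` (route TARGET) and `symmetricScarExists_proof`
(the crux BY NAME), sorry-free modulo the stubs.

## Honest status of the bet (lead's analysis, cycle 1)

`stub_oneGoodSlice` for the class is EQUIVALENT to "every smooth apex profile has a regular origin"
(= the route target `X` on classical representatives): (⇒) is this file + Pineau–Vicol's one-slice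
ε-regularity; (⇐) a regular origin makes `U(s) = √(−t)u → 0` with its `s`-derivative as `s → +∞`;
and in any world containing a time-periodic (λ-DSS) or recurrent non-steady apex Leray profile all
three bet stubs are FALSE (action per period > 0; `inf_s sup_{B_R} ‖∂ₛU‖ > 0` by analyticity +
backward uniqueness).  No monotonicity formula for the Navier–Stokes zoom flow is known
(Albritton–Barker 2019 §1); the small-constant corner `C < c₀` (ε-regularity / KNSS small Liouville)
is the only unconditional fragment.  So the line is CLOSED MODULO (i) two known-mathematics
regularity stubs and (ii) one X-equivalent bet.
-/

noncomputable section

open MeasureTheory Set Function Filter Topology TopologicalSpace Metric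
open scoped NNReal ENNReal

namespace Summit.NavierStokesRegularity.NavierStokesRegularity.Cruxes.SymmetricScarExists.Lines.LogtimeBernoulliCertificate

open Literature.Analysis.FluidPDE
open Summit.NavierStokesRegularity.NavierStokesRegularity.Theses.RellichScar
open Summit.NavierStokesRegularity.NavierStokesRegularity.Theorems.SymmetricScarExists.LogtimeBernoulli

set_option linter.dupNamespace false

/-! ## Registered stubs (v2) -/

/-- STUB 1a — LANDED (p74461): the classical representative of an apex profile
(`Theorems/RellichScarSymmetricScarExistsApexClassicalRepresentative.lean`). -/
theorem apexClassicalRepresentative :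
    ∀ (u : ℝ → EuclideanSpace ℝ (Fin 3) → EuclideanSpace ℝ (Fin 3)) (p : ℝ → EuclideanSpace ℝ (Fin 3) → ℝ) (G : ℝ → EuclideanSpace ℝ (Fin 3) → EuclideanSpace ℝ (Fin 3) →L[ℝ] EuclideanSpace ℝ (Fin 3)) (C : ℝ), Literature.Analysis.FluidPDE.IsSuitableWeakSolutionOn (Literature.Analysis.FluidPDE.slab (EuclideanSpace ℝ (Fin 3)) (Set.Iio 0) isOpen_Iio) 1 0 u p → Literature.Analysis.FluidPDE.HasWeakSpatialGradientOn (Literature.Analysis.FluidPDE.slab (EuclideanSpace ℝ (Fin 3)) (Set.Iio 0) isOpen_Iio) u G → Literature.Analysis.FluidPDE.typeIBound (Set.Iio (0 : ℝ) ×ˢ Set.univ) u p G < ⊤ → Literature.Analysis.FluidPDE.HasTypeIDecay C u → ∃ (v : ℝ → EuclideanSpace ℝ (Fin 3) → EuclideanSpace ℝ (Fin 3)) (q : ℝ → EuclideanSpace ℝ (Fin 3) → ℝ), Literature.Analysis.FluidPDE.IsClassicalNSSolutionOn (Set.Iio 0) 1 0 v q ∧ Function.uncurry v =ᵐ[MeasureTheory.volume.restrict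 (Set.Iio (0 : ℝ) ×ˢ (Set.univ : Set (EuclideanSpace ℝ (Fin 3))))] Function.uncurry u :=
  stub_apexClassicalRepresentative

/-- STUB 1b — DERIVED, now fully LANDED: scale-invariant bounds with the Riesz pressure, from the landed STUB 1b′
`LogtimeBernoulli.stub_typeITimeDerivDecay` (p91030) through the landed `stub_apexScaleInvariantBounds_ofTimeDerivDecay`
(p87966; with p75084, p76080, p77049, p78247, p78405). -/
theorem apexScaleInvariantBounds :
    ∀ (v : ℝ → EuclideanSpace ℝ (Fin 3) → EuclideanSpace ℝ (Fin 3)) (q : ℝ → EuclideanSpace ℝ (Fin 3) → ℝ) (C : ℝ), Literature.Analysis.FluidPDE.IsClassicalNSSolutionOn (Set.Iio 0) 1 0 v q → Literature.Analysis.FluidPDE.HasTypeIDecay C v → ∃ (q' : ℝ → EuclideanSpace ℝ (Fin 3) → ℝ) (K : ℝ), Literature.Analysis.FluidPDE.IsClassicalNSSolutionOn (Set.Iio 0) 1 0 v q' ∧ ∀ t < (0 : ℝ), ∀ (x : EuclideanSpace ℝ (Fin 3)), (‖x‖ + Real.sqrt (-t)) ^ 2 * ‖fderiv ℝ (v t)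 x‖ ≤ K ∧ (‖x‖ + Real.sqrt (-t)) ^ 3 * ‖iteratedFDeriv ℝ 2 (v t) x‖ ≤ K ∧ (‖x‖ + Real.sqrt (-t)) ^ 2 * |q' t x| ≤ K ∧ (‖x‖ + Real.sqrt (-t)) ^ 3 * ‖gradient (q' t) x‖ ≤ K ∧ (‖x‖ + Real.sqrt (-t)) ^ 3 * ‖Literature.Analysis.FluidPDE.timeDeriv v t x‖ ≤ K ∧ (‖x‖ + Real.sqrt (-t)) ^ 4 * ‖fderiv ℝ (Literature.Analysis.FluidPDE.timeDeriv v t) x‖ ≤ K :=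
  stub_apexScaleInvariantBounds_ofTimeDerivDecay
    _root_.Summit.NavierStokesRegularity.NavierStokesRegularity.Theorems.SymmetricScarExists.LogtimeBernoulli.stub_typeITimeDerivDecay

/-- STUB 4′ (THE BET, weakest sufficient form; held by the lead): every eternal backward-Leray profile
in the weighted class has, for every `δ, R > 0`, ONE slice `s̄` with `‖∂ₛU(s̄,y)‖ ≤ δ` on `B_R`.
Equivalent (given Pineau–Vicol's ε-regularity, STUB 6) to a regular origin for `ofLerayOrbit U`;
false in any world with a time-periodic non-steady (λ-DSS) apex Leray profile. -/
theorem stub_oneGoodSlice :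
    ∀ (C K : ℝ) (U : ℝ → EuclideanSpace ℝ (Fin 3) → EuclideanSpace ℝ (Fin 3)) (P : ℝ → EuclideanSpace ℝ (Fin 3) → ℝ), (Literature.Analysis.FluidPDE.IsBackwardLeraySolutionOn (Set.univ : Set ℝ) 1 U P ∧ ∀ (s : ℝ) (y : EuclideanSpace ℝ (Fin 3)), (1 + ‖y‖) * ‖U s y‖ ≤ C ∧ (1 + ‖y‖) ^ 2 * ‖fderiv ℝ (U s) y‖ ≤ K ∧ (1 + ‖y‖) ^ 3 * ‖iteratedFDeriv ℝ 2 (U s) y‖ ≤ K ∧ (1 + ‖y‖) ^ 2 * |P s y| ≤ K ∧ (1 + ‖y‖) ^ 3 * ‖gradient (P s) y‖ ≤ K ∧ (1 + ‖y‖) * ‖Literature.Analysis.FluidPDE.timeDerivWithin (Set.univ : Set ℝ) U s y‖ ≤ K ∧ (1 + ‖y‖) ^ 2 * ‖fderiv ℝ (fun z => Literature.Analysis.FluidPDE.timeDerivWithin (Set.univ : Set ℝ) U s z) y‖ ≤ K ∧ (1 + ‖y‖) ^ 3 * ‖Literature.Analysis.FluidPDE.timeDerivWithin (Set.univ : Set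 ℝ) U s y + (1 / 2 : ℝ) • U s y + (1 / 2 : ℝ) • fderiv ℝ (U s) y y‖ ≤ K) → ∀ δ : ℝ, 0 < δ → ∀ R : ℝ, 0 < R → (∃ sbar : ℝ, ∀ y : EuclideanSpace ℝ (Fin 3), ‖y‖ < R → ‖Literature.Analysis.FluidPDE.timeDerivWithin (Set.univ : Set ℝ) U sbar y‖ ≤ δ) := by
  sorry

/-- STUB 4 (stronger bet, the card's transfer target `C⁺`): FINITE GAUSSIAN ACTION
`∫_{s₁}^{s₂}∫‖∂ₛU‖² e^{−|y|²/4} ≤ A`.  Implies STUB 4′ by the landed `stub_smallDefectSlice`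
(`oneGoodSlice_of_finiteGaussianAction`). -/
theorem stub_finiteGaussianAction :
    ∀ (C K : ℝ) (U : ℝ → EuclideanSpace ℝ (Fin 3) → EuclideanSpace ℝ (Fin 3)) (P : ℝ → EuclideanSpace ℝ (Fin 3) → ℝ), (Literature.Analysis.FluidPDE.IsBackwardLeraySolutionOn (Set.univ : Set ℝ) 1 U P ∧ ∀ (s : ℝ) (y : EuclideanSpace ℝ (Fin 3)), (1 + ‖y‖) * ‖U s y‖ ≤ C ∧ (1 + ‖y‖) ^ 2 * ‖fderiv ℝ (U s) y‖ ≤ K ∧ (1 + ‖y‖) ^ 3 * ‖iteratedFDeriv ℝ 2 (U s) y‖ ≤ K ∧ (1 + ‖y‖) ^ 2 * |P s y| ≤ K ∧ (1 + ‖y‖) ^ 3 * ‖gradient (P s) y‖ ≤ K ∧ (1 + ‖y‖) * ‖Literature.Analysis.FluidPDE.timeDerivWithin (Set.univ : Set ℝ) U s y‖ ≤ K ∧ (1 + ‖y‖) ^ 2 * ‖fderiv ℝ (fun z => Literature.Analysis.FluidPDE.timeDerivWithin (Set.univ : Set ℝ) U s z) y‖ ≤ K ∧ (1 + ‖y‖)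 ^ 3 * ‖Literature.Analysis.FluidPDE.timeDerivWithin (Set.univ : Set ℝ) U s y + (1 / 2 : ℝ) • U s y + (1 / 2 : ℝ) • fderiv ℝ (U s) y y‖ ≤ K) → (∃ A : ℝ, ∀ s₁ s₂ : ℝ, s₁ ≤ s₂ → (∫ σ in s₁..s₂, (∫ y : EuclideanSpace ℝ (Fin 3), ‖Literature.Analysis.FluidPDE.timeDerivWithin (Set.univ : Set ℝ) U σ y‖ ^ 2 * Literature.Analysis.FluidPDE.PineauVicol2026.gaussWeight y)) ≤ A) := by
  sorry

/-- STUB 3 (strongest bet, the card's LOG-TIME LYAPUNOV CERTIFICATE): a bounded slice functional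
`V` whose drop dominates the Gaussian action.  With an arbitrary `V` this is equivalent to a UNIFORM
finite Gaussian action (define `V` as `−c ×` the action accumulated along the unique trajectory
through the slice); implies STUB 4 by the landed window law (`finiteGaussianAction_of_certificate`). -/
theorem stub_logtimeBernoulliCertificate :
    ∀ (C K : ℝ), ∃ (V : (EuclideanSpace ℝ (Fin 3) → EuclideanSpace ℝ (Fin 3)) → (EuclideanSpace ℝ (Fin 3) → ℝ) → ℝ) (c B : ℝ), 0 < c ∧ ∀ (U : ℝ → EuclideanSpace ℝ (Fin 3) → EuclideanSpace ℝ (Fin 3)) (P : ℝ → EuclideanSpace ℝ (Fin 3) → ℝ), (Literature.Analysis.FluidPDE.IsBackwardLeraySolutionOn (Set.univ : Set ℝ) 1 U P ∧ ∀ (s : ℝ) (y : EuclideanSpace ℝ (Fin 3)), (1 + ‖y‖) * ‖U s y‖ ≤ C ∧ (1 + ‖y‖) ^ 2 * ‖fderiv ℝ (U s) y‖ ≤ K ∧ (1 + ‖y‖) ^ 3 * ‖iteratedFDeriv ℝ 2 (U s) y‖ ≤ K ∧ (1 + ‖y‖) ^ 2 * |P s y| ≤ K ∧ (1 + ‖y‖)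 ^ 3 * ‖gradient (P s) y‖ ≤ K ∧ (1 + ‖y‖) * ‖Literature.Analysis.FluidPDE.timeDerivWithin (Set.univ : Set ℝ) U s y‖ ≤ K ∧ (1 + ‖y‖) ^ 2 * ‖fderiv ℝ (fun z => Literature.Analysis.FluidPDE.timeDerivWithin (Set.univ : Set ℝ) U s z) y‖ ≤ K ∧ (1 + ‖y‖) ^ 3 * ‖Literature.Analysis.FluidPDE.timeDerivWithin (Set.univ : Set ℝ) U s y + (1 / 2 : ℝ) • U s y + (1 / 2 : ℝ) • fderiv ℝ (U s) y y‖ ≤ K) → ((∀ s : ℝ, (∫ y : EuclideanSpace ℝ (Fin 3), ‖U s y‖ ^ 2 * Literature.Analysis.FluidPDE.PineauVicol2026.gaussWeight y) ≤ C ^ 2 * (∫ y : EuclideanSpace ℝ (Fin 3), Literature.Analysis.FluidPDE.PineauVicol2026.gaussWeight y)) ∧ ∀ s₁ s₂ : ℝ, s₁ ≤ s₂ → (1 / 2 : ℝ) * (∫ y : EuclideanSpace ℝ (Fin 3), ‖U s₂ y‖ ^ 2 * Literature.Analysis.FluidPDE.PineauVicol2026.gaussWeight y) - (1 / 2 : ℝ)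 * (∫ y : EuclideanSpace ℝ (Fin 3), ‖U s₁ y‖ ^ 2 * Literature.Analysis.FluidPDE.PineauVicol2026.gaussWeight y) = -(∫ σ in s₁..s₂, ((∫ y : EuclideanSpace ℝ (Fin 3), Literature.Analysis.FluidPDE.frobeniusNormSq (fderiv ℝ (U σ) y) * Literature.Analysis.FluidPDE.PineauVicol2026.gaussWeight y) + (1 / 2 : ℝ) * (∫ y : EuclideanSpace ℝ (Fin 3), ‖U σ y‖ ^ 2 * Literature.Analysis.FluidPDE.PineauVicol2026.gaussWeight y) + (1 / 2 : ℝ) * (∫ y : EuclideanSpace ℝ (Fin 3), (P σ y + (1 / 2 : ℝ) * ‖U σ y‖ ^ 2) * inner ℝ y (U σ y) * Literature.Analysis.FluidPDE.PineauVicol2026.gaussWeight y)))) → (∀ s : ℝ, |V (U s) (P s)| ≤ B) ∧ ∀ s₁ s₂ : ℝ, s₁ ≤ s₂ → c * (∫ σ in s₁..s₂, (∫ y : EuclideanSpace ℝ (Fin 3), ‖Literature.Analysis.FluidPDE.timeDerivWithin (Set.univ : Set ℝ) U σ y‖ ^ 2 * Literature.Analysis.FluidPDE.PineauVicol2026.gaussWeight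 y)) ≤ V (U s₁) (P s₁) - V (U s₂) (P s₂) := by
  sorry

/-! ## Composition (sorry-free modulo the stubs) -/

/-- STUB 1 of the original skeleton, now DERIVED: apex profile ⇒ smooth eternal backward-Leray profile
with the eight weighted bounds, a.e. equal, origin still singular (landed reduction
`apexLerayProfile_of_representative_of_bounds` + landed STUB 1a + STUB 1b derived from 1b′). -/
theorem apexLerayProfile :
    ∀ (u : ℝ → EuclideanSpace ℝ (Fin 3) → EuclideanSpace ℝ (Fin 3)) (p : ℝ → EuclideanSpace ℝ (Fin 3) → ℝ) (G : ℝ → EuclideanSpace ℝ (Fin 3) → EuclideanSpace ℝ (Fin 3) →L[ℝ] EuclideanSpace ℝ (Fin 3)) (C : ℝ), Literature.Analysis.FluidPDE.IsSuitableWeakSolutionOn (Literature.Analysis.FluidPDE.slab (EuclideanSpace ℝ (Fin 3)) (Set.Iio 0) isOpen_Iio) 1 0 u p → Literature.Analysis.FluidPDE.HasWeakSpatialGradientOn (Literature.Analysis.FluidPDE.slab (EuclideanSpace ℝ (Fin 3)) (Set.Iio 0) isOpen_Iio) u G → Literature.Analysis.FluidPDE.typeIBound (Set.Iio (0 : ℝ)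 ×ˢ Set.univ) u p G < ⊤ → Literature.Analysis.FluidPDE.HasTypeIDecay C u → Literature.Analysis.FluidPDE.IsBackwardSingularPoint u 0 → ∃ (U : ℝ → EuclideanSpace ℝ (Fin 3) → EuclideanSpace ℝ (Fin 3)) (P : ℝ → EuclideanSpace ℝ (Fin 3) → ℝ) (K : ℝ), (Literature.Analysis.FluidPDE.IsBackwardLeraySolutionOn (Set.univ : Set ℝ) 1 U P ∧ ∀ (s : ℝ) (y : EuclideanSpace ℝ (Fin 3)), (1 + ‖y‖) * ‖U s y‖ ≤ C ∧ (1 + ‖y‖) ^ 2 * ‖fderiv ℝ (U s) y‖ ≤ K ∧ (1 + ‖y‖) ^ 3 * ‖iteratedFDeriv ℝ 2 (U s) y‖ ≤ K ∧ (1 + ‖y‖) ^ 2 * |P s y| ≤ K ∧ (1 + ‖y‖) ^ 3 * ‖gradient (P s) y‖ ≤ K ∧ (1 + ‖y‖) * ‖Literature.Analysis.FluidPDE.timeDerivWithin (Set.univ : Set ℝ) U s y‖ ≤ K ∧ (1 + ‖y‖) ^ 2 * ‖fderiv ℝ (fun z => Literature.Analysis.FluidPDE.timeDerivWithin (Set.univ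 : Set ℝ) U s z) y‖ ≤ K ∧ (1 + ‖y‖) ^ 3 * ‖Literature.Analysis.FluidPDE.timeDerivWithin (Set.univ : Set ℝ) U s y + (1 / 2 : ℝ) • U s y + (1 / 2 : ℝ) • fderiv ℝ (U s) y y‖ ≤ K) ∧ (Function.uncurry (Literature.Analysis.FluidPDE.ofLerayOrbit U) =ᵐ[MeasureTheory.volume.restrict (Set.Iio (0 : ℝ) ×ˢ (Set.univ : Set (EuclideanSpace ℝ (Fin 3))))] Function.uncurry u) ∧ Literature.Analysis.FluidPDE.IsBackwardSingularPoint (Literature.Analysis.FluidPDE.ofLerayOrbit U) 0 :=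
  apexLerayProfile_of_representative_of_bounds apexClassicalRepresentative
    apexScaleInvariantBounds

/-- STUB 4 ⇒ STUB 4′ (landed `stub_smallDefectSlice`). [folklore] -/
theorem oneGoodSlice_of_finiteGaussianAction :
    ∀ (C K : ℝ) (U : ℝ → EuclideanSpace ℝ (Fin 3) → EuclideanSpace ℝ (Fin 3)) (P : ℝ → EuclideanSpace ℝ (Fin 3) → ℝ), (Literature.Analysis.FluidPDE.IsBackwardLeraySolutionOn (Set.univ : Set ℝ) 1 U P ∧ ∀ (s : ℝ) (y : EuclideanSpace ℝ (Fin 3)), (1 + ‖y‖) * ‖U s y‖ ≤ C ∧ (1 + ‖y‖) ^ 2 * ‖fderiv ℝ (U s) y‖ ≤ K ∧ (1 + ‖y‖) ^ 3 * ‖iteratedFDeriv ℝ 2 (U s) y‖ ≤ K ∧ (1 + ‖y‖) ^ 2 * |P s y| ≤ K ∧ (1 + ‖y‖) ^ 3 * ‖gradient (P s) y‖ ≤ K ∧ (1 + ‖y‖) * ‖Literature.Analysis.FluidPDE.timeDerivWithin (Set.univ : Set ℝ) U s y‖ ≤ K ∧ (1 + ‖y‖) ^ 2 * ‖fderiv ℝ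 (fun z => Literature.Analysis.FluidPDE.timeDerivWithin (Set.univ : Set ℝ) U s z) y‖ ≤ K ∧ (1 + ‖y‖) ^ 3 * ‖Literature.Analysis.FluidPDE.timeDerivWithin (Set.univ : Set ℝ) U s y + (1 / 2 : ℝ) • U s y + (1 / 2 : ℝ) • fderiv ℝ (U s) y y‖ ≤ K) → ∀ δ : ℝ, 0 < δ → ∀ R : ℝ, 0 < R → (∃ sbar : ℝ, ∀ y : EuclideanSpace ℝ (Fin 3), ‖y‖ < R → ‖Literature.Analysis.FluidPDE.timeDerivWithin (Set.univ : Set ℝ) U sbar y‖ ≤ δ) := fun C K U P hLB δ hδ R hR =>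
  stub_smallDefectSlice C K U P hLB (stub_finiteGaussianAction C K U P hLB) δ hδ R hR

/-- STUBS 2 (landed) + 3 ⇒ STUB 4's conclusion: `c·Act(s₁,s₂) ≤ V(s₁) − V(s₂) ≤ 2B`. [folklore] -/
theorem finiteGaussianAction_of_certificate :
    ∀ (C K : ℝ) (U : ℝ → EuclideanSpace ℝ (Fin 3) → EuclideanSpace ℝ (Fin 3)) (P : ℝ → EuclideanSpace ℝ (Fin 3) → ℝ), (Literature.Analysis.FluidPDE.IsBackwardLeraySolutionOn (Set.univ : Set ℝ) 1 U P ∧ ∀ (s : ℝ) (y : EuclideanSpace ℝ (Fin 3)), (1 + ‖y‖) * ‖U s y‖ ≤ C ∧ (1 + ‖y‖) ^ 2 * ‖fderiv ℝ (U s) y‖ ≤ K ∧ (1 + ‖y‖) ^ 3 * ‖iteratedFDeriv ℝ 2 (U s) y‖ ≤ K ∧ (1 + ‖y‖) ^ 2 * |P s y| ≤ K ∧ (1 + ‖y‖) ^ 3 * ‖gradient (P s) y‖ ≤ K ∧ (1 + ‖y‖) * ‖Literature.Analysis.FluidPDE.timeDerivWithin (Set.univ : Set ℝ) U s y‖ ≤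 K ∧ (1 + ‖y‖) ^ 2 * ‖fderiv ℝ (fun z => Literature.Analysis.FluidPDE.timeDerivWithin (Set.univ : Set ℝ) U s z) y‖ ≤ K ∧ (1 + ‖y‖) ^ 3 * ‖Literature.Analysis.FluidPDE.timeDerivWithin (Set.univ : Set ℝ) U s y + (1 / 2 : ℝ) • U s y + (1 / 2 : ℝ) • fderiv ℝ (U s) y y‖ ≤ K) → (∃ A : ℝ, ∀ s₁ s₂ : ℝ, s₁ ≤ s₂ → (∫ σ in s₁..s₂, (∫ y : EuclideanSpace ℝ (Fin 3), ‖Literature.Analysis.FluidPDE.timeDerivWithin (Set.univ : Set ℝ) U σ y‖ ^ 2 * Literature.Analysis.FluidPDE.PineauVicol2026.gaussWeight y)) ≤ A) := by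
  intro C K U P hLB
  obtain ⟨V, c, B, hc, hcert⟩ := stub_logtimeBernoulliCertificate C K
  obtain ⟨hV, hdrop⟩ := hcert U P hLB (stub_gaussianWindowLaw C K U P hLB)
  refine ⟨2 * B / c, fun s₁ s₂ hs => ?_⟩
  have h1 := hdrop s₁ s₂ hs
  have h2 : V (U s₁) (P s₁) - V (U s₂) (P s₂) ≤ 2 * B := by
    have ha := hV s₁
    have hb := hV s₂
    rw [abs_le] at ha hb
    linarith
  rw [le_div_iff₀ hc]
  linarith

/-- **The stubs prove the route TARGET `NoApexTypeIProfile`**: smooth Leray representative (1a+1b)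
⇒ one good slice (4′) ⇒ regular origin by Pineau–Vicol's one-slice theorem (landed STUBS 6, 7) —
contradicting the singularity of the representative. -/
theorem noApexTypeIProfile_of_stubs : NoApexTypeIProfile := by
  intro u p G C hsw hwg hI hdec hsing
  obtain ⟨U, P, K, hLB, -, hsingU⟩ := apexLerayProfile u p G C hsw hwg hI hdec hsing
  obtain ⟨δ, hδ, hcrit⟩ := stub_oneSliceCriterion stub_pineauVicolOneSlice C
  obtain ⟨R, hR, hreg⟩ := hcrit K
  obtain ⟨sbar, hsbar⟩ := stub_oneGoodSlice C K U P hLB δ hδ R hR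
  exact hreg U P hLB ⟨sbar, hsbar⟩ hsingU

/-- From the target to the crux: with no singular apex profile the antecedent of
`SymmetricScarExists` is empty. [folklore] -/
theorem symmetricScarExists_of_noApexTypeIProfile (hX : NoApexTypeIProfile) : SymmetricScarExists := by
  intro C hex
  obtain ⟨u, p, G, hsw, hwg, hI, hdec, hsing⟩ := hex
  exact absurd hsing (hX u p G C hsw hwg hI hdec)

/-- **The line closes the crux modulo its stubs**: `SymmetricScarExists` BY NAME. -/
theorem symmetricScarExists_proof : SymmetricScarExists :=
  symmetricScarExists_of_noApexTypeIProfile noApexTypeIProfile_of_stubs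

end Summit.NavierStokesRegularity.NavierStokesRegularity.Cruxes.SymmetricScarExists.Lines.LogtimeBernoulliCertificate

end
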